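import Literature.NumberTheory.Automorphic.GodementJacquetPartialL

/-!
# Route `DedekindQuotient1951` (Langlands) — support `PartialLEntire` (stmt-Langlands-17273):
# entire continuation from pointwise non-degenerate zeta-quotient representations

Helper file (complex analysis only). If `L` is holomorphic on a right half-plane `re s > c` and for
EVERY point `s₀ ∈ ℂ` there are entire functions `Z`, `A` with `A(s₀) ≠ 0` and `Z = A · L` on some
right half-plane, then some entire function agrees with `L` on `re s > c`
(`exists_entire_eqOn_halfPlane_of_quotients`; the case `c = 1` is
`hasEntireContinuation_of_quotients`). This is how Godement–Jacquet's Thm. 13.8 (LNM 260) is read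
for the partial L-function `L^S(s, Π)` of a cuspidal `Π` on `GL_n`, `n ≥ 2`: the global zeta integral
`Z(Φ, s, φ, φ)` is entire, the local zeta integral `A` at the places of `S` and at infinity can be made
non-zero at any prescribed point by shrinking the support of the test function, and the meromorphic
continuation (identity principle, `LFunction.exists_meromorphic_extension_of_quotient'`,
`LFunction.exists_meromorphic_eqOn_halfPlane` of `GodementJacquetPartialL`) is then analytic at every
point after removing its removable singularities (`limUnder` along punctured neighbourhoods).
-/

set_option linter.dupNamespace false

noncomputable section

open Filter Topology Set
open Literature.NumberTheory.Automorphic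

namespace Summit.Langlands.Langlands.Theorems.DedekindQuotient1951

/-- The punctured limit of `G` at `z` is `F z` when `G = F` on a punctured neighbourhood of `z` and `F`
is continuous at `z`. [folklore] -/
theorem limUnder_nhdsNE_eq_of_eventuallyEq {G F : ℂ → ℂ} {z : ℂ} (h : ∀ᶠ u in 𝓝[≠] z, G u = F u)
    (hF : ContinuousAt F z) : limUnder (𝓝[≠] z) G = F z := by
  have ht : Tendsto F (𝓝[≠] z) (𝓝 (F z)) := hF.tendsto.mono_left nhdsWithin_le_nhds
  exact (ht.congr' (h.mono fun u hu => hu.symm)).limUnder_eq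

/-- An identity on a punctured neighbourhood of `s₀` holds on a punctured neighbourhood of every
point near `s₀`. [folklore] -/
theorem eventually_eventually_nhdsNE_of_eventually_nhdsNE {G F : ℂ → ℂ} {s₀ : ℂ}
    (h : ∀ᶠ u in 𝓝[≠] s₀, G u = F u) : ∀ᶠ z in 𝓝 s₀, ∀ᶠ u in 𝓝[≠] z, G u = F u := by
  have h1 : ∀ᶠ z in 𝓝[≠] s₀, ∀ᶠ u in 𝓝[≠] z, G u = F u := by
    have h2 := (eventually_eventually_nhdsWithin (s := {s₀}ᶜ) (a := s₀)).2 h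
    filter_upwards [h2, self_mem_nhdsWithin] with z hz hzne
    rw [isOpen_compl_singleton.nhdsWithin_eq hzne] at hz
    exact hz.filter_mono nhdsWithin_le_nhds
  rw [eventually_nhdsWithin_iff] at h1
  filter_upwards [h1] with z hz
  by_cases hzs : z = s₀
  · subst hzs
    exact h
  · exact hz hzs

/-- **Entire continuation from pointwise non-degenerate quotient representations.** Let `L` be
holomorphic on `re s > c`, and suppose that for every `s₀ ∈ ℂ` there are entire `Z`, `A` with
`A(s₀) ≠ 0` and `Z(s) = A(s) L(s)` on some right half-plane `re s > x₀`. Then some entire function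
agrees with `L` on `re s > c`. Proof: one such representation and the identity principle give `G`
meromorphic on `ℂ` with `G = L` on `re s > c` (`LFunction.exists_meromorphic_extension_of_quotient'`,
`LFunction.exists_meromorphic_eqOn_halfPlane`); for each `s₀`, `G - Z/A` is meromorphic on `ℂ` and
vanishes puncturedly far to the right (off the isolated zeros of `A`), hence puncturedly near `s₀`
(Mathlib `MeromorphicOn.meromorphicOrderAt_ne_top_of_isPreconnected`), where `Z/A` is analytic; so
`s ↦ lim_{u → s, u ≠ s} G(u)` is analytic at every point and equals `L` on `re s > c`. [folklore] -/
theorem exists_entire_eqOn_halfPlane_of_quotients {c : ℝ} {L : ℂ → ℂ}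
    (hL : DifferentiableOn ℂ L {s : ℂ | c < s.re})
    (h : ∀ s₀ : ℂ, ∃ (x₀ : ℝ) (Z A : ℂ → ℂ), Differentiable ℂ Z ∧ Differentiable ℂ A ∧ A s₀ ≠ 0 ∧
      ∀ s : ℂ, x₀ < s.re → Z s = A s * L s) :
    ∃ g : ℂ → ℂ, Differentiable ℂ g ∧ ∀ s : ℂ, c < s.re → g s = L s := by
  classical
  -- Step 1: a meromorphic `G` on `ℂ` with `G = L` on `re s > c`
  obtain ⟨G, hG, hGL⟩ : ∃ G : ℂ → ℂ, Meromorphic G ∧ ∀ s : ℂ, c < s.re → G s = L s := by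
    obtain ⟨x₀, Z, A, hZ, hA, hA0, hZA⟩ := h 0
    obtain ⟨G₀, hG₀, hG₀L⟩ := LFunction.exists_meromorphic_extension_of_quotient'
      (fun z => (hZ.analyticAt z).meromorphicAt) (fun z => (hA.analyticAt z).meromorphicAt)
      ⟨0, hA.analyticAt 0, hA0⟩ hZA
    exact LFunction.exists_meromorphic_eqOn_halfPlane hG₀ hG₀L hL
  -- Step 2: near every point `G` agrees puncturedly with an analytic germ
  have key : ∀ s₀ : ℂ, ∃ F : ℂ → ℂ, AnalyticAt ℂ F s₀ ∧ ∀ᶠ z in 𝓝[≠] s₀, G z = F z := by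
    intro s₀
    obtain ⟨x₀, Z, A, hZ, hA, hA0, hZA⟩ := h s₀
    refine ⟨fun z => Z z / A z, (hZ.analyticAt s₀).div (hA.analyticAt s₀) hA0, ?_⟩
    have hAm : Meromorphic A := fun z => (hA.analyticAt z).meromorphicAt
    -- `A` is nowhere locally zero
    have hAord : ∀ z, meromorphicOrderAt A z ≠ ⊤ := by
      have h0 : meromorphicOrderAt A s₀ ≠ ⊤ := by
        rw [meromorphicOrderAt_ne_top_iff_eventually_ne_zero (hAm s₀)]
        exact eventually_nhdsWithin_of_eventually_nhds
          (((hA.analyticAt s₀).continuousAt.ne_iff_eventually_ne continuousAt_const).mp hA0)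
      intro z
      exact hAm.meromorphicOn.meromorphicOrderAt_ne_top_of_isPreconnected isPreconnected_univ
        (mem_univ s₀) (mem_univ z) h0
    -- the difference `D = G - Z/A`
    set D : ℂ → ℂ := fun z => G z - Z z / A z with hD
    have hDm : Meromorphic D := fun z =>
      (hG z).sub (((hZ.analyticAt z).meromorphicAt).div (hAm z))
    set m : ℝ := max x₀ c with hm
    set s₁ : ℂ := ((m + 1 : ℝ) : ℂ) with hs₁
    have hs₁re : s₁.re = m + 1 := by rw [hs₁, Complex.ofReal_re]
    have h₁ : meromorphicOrderAt D s₁ = ⊤ := by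
      rw [meromorphicOrderAt_eq_top_iff]
      have hmem : ∀ᶠ z in 𝓝[≠] s₁, m < z.re := eventually_nhdsWithin_of_eventually_nhds
        ((isOpen_lt continuous_const Complex.continuous_re).mem_nhds
          (show m < s₁.re by rw [hs₁re]; exact lt_add_one _))
      filter_upwards [hmem, (meromorphicOrderAt_ne_top_iff_eventually_ne_zero (hAm s₁)).1 (hAord s₁)]
        with z hz hAz
      simp only [hD]
      rw [hGL z ((le_max_right _ _).trans_lt hz), hZA z ((le_max_left _ _).trans_lt hz),
        mul_div_cancel_left₀ _ hAz, sub_self]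
    have htop : meromorphicOrderAt D s₀ = ⊤ := by
      by_contra hne
      exact hDm.meromorphicOn.meromorphicOrderAt_ne_top_of_isPreconnected isPreconnected_univ
        (mem_univ s₀) (mem_univ s₁) hne h₁
    have h0 : ∀ᶠ z in 𝓝[≠] s₀, D z = 0 := meromorphicOrderAt_eq_top_iff.1 htop
    filter_upwards [h0] with z hz
    simpa only [hD, sub_eq_zero] using hz
  -- Step 3: remove the removable singularities of `G`
  refine ⟨fun s => limUnder (𝓝[≠] s) G, fun s₀ => ?_, fun s hs => ?_⟩
  · obtain ⟨F, hF, hGF⟩ := key s₀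
    have hev : ∀ᶠ z in 𝓝 s₀, limUnder (𝓝[≠] z) G = F z := by
      filter_upwards [eventually_eventually_nhdsNE_of_eventually_nhdsNE hGF, hF.eventually_analyticAt]
        with z hz hFz
      exact limUnder_nhdsNE_eq_of_eventuallyEq hz hFz.continuousAt
    exact (hF.congr (hev.mono fun z hz => hz.symm)).differentiableAt
  · -- on the half-plane `G = L` near `s` and `L` is continuous at `s`
    have hmem : {z : ℂ | c < z.re} ∈ 𝓝 s :=
      (isOpen_lt continuous_const Complex.continuous_re).mem_nhds hs
    have hGL' : ∀ᶠ u in 𝓝[≠] s, G u = L u :=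
      eventually_nhdsWithin_of_eventually_nhds (Filter.eventually_of_mem hmem fun z hz => hGL z hz)
    exact limUnder_nhdsNE_eq_of_eventuallyEq hGL' (hL.differentiableAt hmem).continuousAt

/-- **`HasEntireContinuation` from pointwise non-degenerate quotient representations** (the case
`c = 1` of `exists_entire_eqOn_halfPlane_of_quotients`): an `L`-function holomorphic on `re s > 1`
which, for every `s₀`, is the quotient `Z/A` of entire functions with `A(s₀) ≠ 0` on some right
half-plane, has entire continuation. [folklore] -/
theorem hasEntireContinuation_of_quotients {L : ℂ → ℂ}
    (hL : DifferentiableOn ℂ L {s : ℂ | 1 < s.re})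
    (h : ∀ s₀ : ℂ, ∃ (x₀ : ℝ) (Z A : ℂ → ℂ), Differentiable ℂ Z ∧ Differentiable ℂ A ∧ A s₀ ≠ 0 ∧
      ∀ s : ℂ, x₀ < s.re → Z s = A s * L s) :
    Literature.NumberTheory.GaloisRepresentations.LFunction.HasEntireContinuation L :=
  exists_entire_eqOn_halfPlane_of_quotients hL h

end Summit.Langlands.Langlands.Theorems.DedekindQuotient1951

end
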